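import Summits.ResolutionOfSingularities.ResolutionOfSingularities.Theorems.PurelyInseparableDim4ResConeTranslatedStepWitness
import HarnessLib
import HarnessLib.Audit.Tags

/-!
# Purely inseparable four-folds — THE CLOSED MULTINOMIAL COEFFICIENT LAW OF A TRANSLATED POINT STEP: `coeff_e shear_j^b(x^m)` for a
# general translation set, the coefficient of the sheared polynomial as a sum over parents, and the step edition
# (cell `res-dim4-pi`, K2(p) lane, ROW B-LOSSY kernel vocabulary; every `q`, every chart point)

[OURS · counted 0 · cell `res-dim4-pi` · K2(p) lane holder res-dim4-p-12 g5 (g5-25: B-LOSSY tool-box = res-dim4-p-5 g6 support half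
`…TranslatedStepAxis` + res-dim4-p-11 g6 coefficient half `…TranslatedStepWitness` p724675); TEXT res-dim4-p-7 g6 bus 2026-08-29T13:54:34Z (2)
«the child coefficient of E′ is Σ_{t̃ ≥ 0 on S, |t̃| ≤ E_i} C(E_S + t̃, t̃) b^{t̃} · coeff (E + t̃ − |t̃|·e_i)», datum `transstep_check` 3e6d51b51673cc1b
(14,400 / 14,400); seat res-dim4-p-11 g6.]  Nothing here proves any TAIL(p, d, 3), K2(7), K2(p), `NoIsolatedTrap p p` or resolution of singularities
in dimension ≥ 4 / characteristic `p` — NOT proved; pure bookkeeping of ONE step of OUR frame.  AI kernel work, weaker than expert review.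

The one-letter law `coeff_shear_single` (res-dim4-p-5 g3, `…ResConeShearTransport`) made multi-letter: for the shear `x_i ↦ x_i + b_i x_j` (`i ≠ j`,
`b_j = 0`) of the `x_j`-chart at the chart point `b`,
* **`coeff_shear_monomial`** — `coeff_e (shear j b (x^m)) = [|e| = |m|] · ∏_{i ≠ j} C(m_i, e_i) · b_i^{m_i − e_i}`: choose which `e_i` of the `m_i`
  factors `x_i + b_i x_j` give `x_i`; an untranslated letter (`b_i = 0`) contributes `[e_i = m_i]` (`0^0 = 1`), a letter with `e_i > m_i` contributes
  `C = 0`, and the `x_j`-exponent is dictated by the degree (induction on `|m|`, one variable at a time, Pascal's rule);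
* **`coeff_shear_eq_sum_parents`** — `coeff_e (shear j b F) = Σ_{m ∈ supp F, |m| = |e|} (∏_{i ≠ j} C(m_i, e_i) b_i^{m_i − e_i}) · coeff_m F`: the
  PARENTS of `e` are the `m` above `e` in the canceller order of `…TranslatedStepWitness` (the other summands vanish);
* **`coeff_step_chartExponent_eq_sum_parents`** — the step edition through `coeff_step_F_chartExponent`: the child coefficient at the chart image
  `chartExponent q univ j e` is that sum, or `0` if the image is a `q`-th power (cleaning).  With `e = E′ − t` running over the lowered images of a
  parent `E` this is p-7's birth/cancellation formula (2) verbatim; Lucas' theorem for `C(·,·) mod p` is left to the user.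
[cite: Hauser2010, §§F–G, §I (P⁺ = P(y + t·y_m))] [cite: HauserPerlega2019PRIMS, §2 (transform at a translated point)]
bears_on: LADDER-RESOLUTION:D157-DOOR2 (res-dim4-pi · K2(p) · B-LOSSY kernel vocabulary · multinomial coefficient law).
Supports stmt-ResolutionOfSingularities-16155 (helper).
-/

set_option linter.dupNamespace false -- mandated namespace of this single-conjunct summit

noncomputable section

namespace Summit.ResolutionOfSingularities.ResolutionOfSingularities.Theorems.PIDim4

namespace ResCone

open MvPolynomial Finset
open Literature.AlgebraicGeometry.Resolution
open Literature.AlgebraicGeometry.Resolution.CentreBlowup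
open Literature.AlgebraicGeometry.Resolution.Hauser2010
open Literature.AlgebraicGeometry.Resolution.HauserPerlega2019

variable {K : Type} [Field K]

/-! ## 1. The multinomial weight: vanishing and degree bookkeeping -/

section Weight

/-- If the `s`-mass of `e` exceeds that of `m`, some factor `C(m_i, e_i)` (`i ∈ s`) vanishes, so the multinomial weight over `s` is `0`.
[folklore] -/
theorem prod_choose_mul_pow_eq_zero_of_sum_lt (s : Finset (Fin 4)) (b : Fin 4 → K) {m e : Fin 4 →₀ ℕ}
    (h : ∑ i ∈ s, m i < ∑ i ∈ s, e i) :
    ∏ i ∈ s, (((m i).choose (e i) : ℕ) : K) * b i ^ (m i - e i) = 0 := by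
  obtain ⟨i, hi, hlt⟩ := Finset.exists_lt_of_sum_lt h
  exact Finset.prod_eq_zero hi (by rw [Nat.choose_eq_zero_of_lt hlt, Nat.cast_zero, zero_mul])

/-- Off-`j` mass versus degree: `Σ_{i ≠ j} m_i + m_j = |m|`. [folklore] -/
theorem sum_erase_add_apply_eq_degree (j : Fin 4) (m : Fin 4 →₀ ℕ) :
    ∑ i ∈ Finset.univ.erase j, m i + m j = m.degree := by
  rw [Finsupp.degree_eq_sum, ← Finset.add_sum_erase _ _ (Finset.mem_univ j), add_comm]

/-- Off-`{j, k}` mass versus degree (`k ≠ j`): `Σ_{i ≠ j, k} m_i + m_k + m_j = |m|`. [folklore] -/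
theorem sum_erase_erase_add_eq_degree {j k : Fin 4} (hkj : k ≠ j) (m : Fin 4 →₀ ℕ) :
    ∑ i ∈ (Finset.univ.erase j).erase k, m i + m k + m j = m.degree := by
  rw [← sum_erase_add_apply_eq_degree j m,
    ← Finset.add_sum_erase _ _ (Finset.mem_erase.mpr ⟨hkj, Finset.mem_univ k⟩), add_comm (m k)]

/-- Degree of `e − e_l` when `e_l ≥ 1`. [folklore] -/
theorem degree_sub_single_add_one {e : Fin 4 →₀ ℕ} {l : Fin 4} (h : 1 ≤ e l) :
    (e - Finsupp.single l 1).degree + 1 = e.degree := by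
  have h' := congrArg Finsupp.degree (tsub_add_cancel_of_le (Finsupp.single_le_iff.mpr h))
  rw [map_add, Finsupp.degree_single] at h'
  exact h'

end Weight

/-! ## 2. The coefficient law of a sheared monomial -/

section ShearMonomial

/-- **THE MULTINOMIAL COEFFICIENT LAW OF THE SHEAR** (`b_j = 0`):
`coeff_e (shear j b (x^m)) = [|e| = |m|] · ∏_{i ≠ j} C(m_i, e_i) · b_i^{m_i − e_i}`. [folklore]
[cite: Hauser2010, §I (definition of P⁺)] -/
theorem coeff_shear_monomial (j : Fin 4) {b : Fin 4 → K} (hbj : b j = 0) (m e : Fin 4 →₀ ℕ) :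
    coeff e (shear j b (monomial m (1 : K))) =
      if e.degree = m.degree then ∏ i ∈ Finset.univ.erase j, (((m i).choose (e i) : ℕ) : K) * b i ^ (m i - e i) else 0 := by
  classical
  induction hn : m.degree generalizing m e with
  | zero =>
    have hm : m = 0 := (Finsupp.degree_eq_zero_iff m).mp hn
    subst hm
    have h1 : shear j b (monomial (0 : Fin 4 →₀ ℕ) (1 : K)) = 1 := by
      rw [show monomial (0 : Fin 4 →₀ ℕ) (1 : K) = C 1 from rfl, C_1]
      unfold shear
      rw [map_one]
    rw [h1, show (1 : MvPolynomial (Fin 4) K) = monomial 0 1 from rfl, coeff_monomial]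
    by_cases he : e.degree = 0
    · have he0 : e = 0 := (Finsupp.degree_eq_zero_iff e).mp he
      subst he0
      rw [if_pos rfl, if_pos he, Finset.prod_eq_one]
      intro i _
      rw [Finsupp.coe_zero, Pi.zero_apply, Nat.choose_zero_right, Nat.cast_one, one_mul, Nat.sub_zero, pow_zero]
    · rw [if_neg (fun h => he (by rw [← h, map_zero])), if_neg he]
  | succ n ih =>
    -- split off one variable: `m = m' + e_k`
    have hm0 : m ≠ 0 := by
      intro h; rw [h, map_zero] at hn; exact Nat.succ_ne_zero n hn.symm
    obtain ⟨k, hk⟩ := Finsupp.ne_iff.mp hm0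
    rw [Finsupp.coe_zero, Pi.zero_apply] at hk
    obtain ⟨m', hmk⟩ : ∃ m' : Fin 4 →₀ ℕ, m = m' + Finsupp.single k 1 :=
      ⟨m - Finsupp.single k 1,
        (tsub_add_cancel_of_le (Finsupp.single_le_iff.mpr (Nat.one_le_iff_ne_zero.mpr hk))).symm⟩
    have hdeg' : m'.degree = n := by
      have h := congrArg Finsupp.degree hmk
      rw [map_add, Finsupp.degree_single] at h
      omega
    have hmdeg : m.degree = m'.degree + 1 := by rw [hn, hdeg']
    have hmi : ∀ i, i ≠ k → m i = m' i := fun i hi => by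
      rw [hmk, Finsupp.add_apply, Finsupp.single_eq_of_ne hi, add_zero]
    have hmk1 : m k = m' k + 1 := by rw [hmk, Finsupp.add_apply, Finsupp.single_eq_same]
    have hsplit : monomial m (1 : K) = monomial m' 1 * X k := by
      rw [X, monomial_mul, mul_one, ← hmk]
    have hmul : shear j b (monomial m (1 : K)) = shear j b (monomial m' 1) * shear j b (X k) := by
      rw [hsplit]; unfold shear; rw [map_mul]
    rw [hmul, ← hn]
    by_cases hkj : k = j
    · ----------------------------------------------------------------- the chart letter: `shear X_j = X_j`
      subst hkj
      rw [shear_X_self, coeff_mul_X']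
      by_cases hek : k ∈ e.support
      · have hek1 : 1 ≤ e k := Nat.one_le_iff_ne_zero.mpr (Finsupp.mem_support_iff.mp hek)
        have hedeg := degree_sub_single_add_one hek1
        rw [if_pos hek, ih m' (e - Finsupp.single k 1) hdeg']
        have hprod : ∏ i ∈ Finset.univ.erase k, ((((m' i).choose ((e - Finsupp.single k 1 : Fin 4 →₀ ℕ) i) : ℕ) : K) *
              b i ^ (m' i - (e - Finsupp.single k 1 : Fin 4 →₀ ℕ) i)) =
            ∏ i ∈ Finset.univ.erase k, ((((m i).choose (e i) : ℕ) : K) * b i ^ (m i - e i)) := by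
          refine Finset.prod_congr rfl fun i hi => ?_
          rw [hmi i (Finset.ne_of_mem_erase hi), Finsupp.tsub_apply, Finsupp.single_eq_of_ne (Finset.ne_of_mem_erase hi),
            Nat.sub_zero]
        rw [hprod]
        by_cases hed : e.degree = m.degree
        · rw [if_pos hed, if_pos (by omega)]
        · rw [if_neg hed, if_neg (by omega)]
      · rw [if_neg hek]
        by_cases hed : e.degree = m.degree
        · rw [if_pos hed]
          refine (prod_choose_mul_pow_eq_zero_of_sum_lt _ b ?_).symm
          have hek0 : e k = 0 := Finsupp.notMem_support_iff.mp hek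
          have h1 := sum_erase_add_apply_eq_degree k m
          have h2 := sum_erase_add_apply_eq_degree k e
          omega
        · rw [if_neg hed]
    · ----------------------------------------------------------------- a sheared letter: `shear X_k = X_k + b_k X_j`
      have hkmem : k ∈ Finset.univ.erase j := Finset.mem_erase.mpr ⟨hkj, Finset.mem_univ k⟩
      rw [shear_X_of_ne hkj, mul_add, coeff_add, coeff_mul_X', ← mul_assoc, mul_comm (shear j b _) (C (b k)), mul_assoc,
        coeff_C_mul, coeff_mul_X']
      -- the common factor over the letters `i ≠ j, k`
      set Rest : K := ∏ i ∈ (Finset.univ.erase j).erase k, ((((m i).choose (e i) : ℕ) : K) * b i ^ (m i - e i)) with hRest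
      -- (a) the weight of `(m', e − e_l)` over `i ≠ j, k` is `Rest` for `l ∈ {k, j}`
      have hrest : ∀ l : Fin 4, (l = k ∨ l = j) →
          ∏ i ∈ (Finset.univ.erase j).erase k, ((((m' i).choose ((e - Finsupp.single l 1 : Fin 4 →₀ ℕ) i) : ℕ) : K) *
              b i ^ (m' i - (e - Finsupp.single l 1 : Fin 4 →₀ ℕ) i)) = Rest := by
        intro l hl
        refine Finset.prod_congr rfl fun i hi => ?_
        have hik : i ≠ k := Finset.ne_of_mem_erase hi
        have hij : i ≠ j := Finset.ne_of_mem_erase (Finset.mem_of_mem_erase hi)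
        have hil : i ≠ l := by rcases hl with rfl | rfl <;> assumption
        rw [hmi i hik, Finsupp.tsub_apply, Finsupp.single_eq_of_ne hil, Nat.sub_zero]
      -- (b) the right-hand side split at `k`
      have hRHS : ∏ i ∈ Finset.univ.erase j, ((((m i).choose (e i) : ℕ) : K) * b i ^ (m i - e i)) =
          ((((m' k + 1).choose (e k) : ℕ) : K) * b k ^ (m' k + 1 - e k)) * Rest := by
        rw [← Finset.mul_prod_erase _ _ hkmem, hmk1]
      -- (c) the two inductive coefficients, when present
      have hT1 : 1 ≤ e k → coeff (e - Finsupp.single k 1) (shear j b (monomial m' (1 : K))) =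
          if e.degree = m.degree then ((((m' k).choose (e k - 1) : ℕ) : K) * b k ^ (m' k + 1 - e k)) * Rest else 0 := by
        intro hek1
        have hedeg := degree_sub_single_add_one hek1
        rw [ih m' (e - Finsupp.single k 1) hdeg', ← Finset.mul_prod_erase _ _ hkmem, hrest k (Or.inl rfl), Finsupp.tsub_apply,
          Finsupp.single_eq_same, show m' k - (e k - 1) = m' k + 1 - e k by omega]
        by_cases hed : e.degree = m.degree
        · rw [if_pos hed, if_pos (by omega)]
        · rw [if_neg hed, if_neg (by omega)]
      have hT2 : 1 ≤ e j → coeff (e - Finsupp.single j 1) (shear j b (monomial m' (1 : K))) =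
          if e.degree = m.degree then ((((m' k).choose (e k) : ℕ) : K) * b k ^ (m' k - e k)) * Rest else 0 := by
        intro hej1
        have hedeg := degree_sub_single_add_one hej1
        rw [ih m' (e - Finsupp.single j 1) hdeg', ← Finset.mul_prod_erase _ _ hkmem, hrest j (Or.inr rfl), Finsupp.tsub_apply,
          Finsupp.single_eq_of_ne hkj, Nat.sub_zero]
        by_cases hed : e.degree = m.degree
        · rw [if_pos hed, if_pos (by omega)]
        · rw [if_neg hed, if_neg (by omega)]
      -- (d) assembly
      by_cases hed : e.degree = m.degree
      swap
      · -- wrong degree: everything vanishes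
        rw [if_neg hed]
        have h1 : (if k ∈ e.support then coeff (e - Finsupp.single k 1) (shear j b (monomial m' (1 : K))) else 0) = 0 := by
          split_ifs with hek
          · rw [hT1 (Nat.one_le_iff_ne_zero.mpr (Finsupp.mem_support_iff.mp hek)), if_neg hed]
          · rfl
        have h2 : (if j ∈ e.support then coeff (e - Finsupp.single j 1) (shear j b (monomial m' (1 : K))) else 0) = 0 := by
          split_ifs with hej
          · rw [hT2 (Nat.one_le_iff_ne_zero.mpr (Finsupp.mem_support_iff.mp hej)), if_neg hed]
          · rfl
        rw [h1, h2, mul_zero, add_zero]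
      rw [if_pos hed, hRHS]
      -- mass bookkeeping available in this branch
      have hdm := sum_erase_erase_add_eq_degree hkj m
      have hde := sum_erase_erase_add_eq_degree hkj e
      have hRest0 : ∑ i ∈ (Finset.univ.erase j).erase k, m i < ∑ i ∈ (Finset.univ.erase j).erase k, e i → Rest = 0 :=
        fun h => prod_choose_mul_pow_eq_zero_of_sum_lt _ b h
      by_cases hej : j ∈ e.support
      · ------------------------------------------------ `e_j ≥ 1`: both inductive terms may be present; Pascal at `k`
        have hej1 : 1 ≤ e j := Nat.one_le_iff_ne_zero.mpr (Finsupp.mem_support_iff.mp hej)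
        rw [if_pos hej, hT2 hej1, if_pos hed]
        by_cases hek : k ∈ e.support
        · have hek1 : 1 ≤ e k := Nat.one_le_iff_ne_zero.mpr (Finsupp.mem_support_iff.mp hek)
          rw [if_pos hek, hT1 hek1, if_pos hed]
          -- Pascal: C(m'_k + 1, e_k) = C(m'_k, e_k − 1) + C(m'_k, e_k)
          obtain ⟨e', he'⟩ : ∃ e', e k = e' + 1 := ⟨e k - 1, by omega⟩
          rw [he', Nat.choose_succ_succ', Nat.add_sub_cancel, Nat.cast_add, show m' k + 1 - (e' + 1) = m' k - e' by omega]
          by_cases hle : e' + 1 ≤ m' k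
          · rw [show m' k - e' = (m' k - (e' + 1)) + 1 by omega, pow_succ]
            ring
          · rw [Nat.choose_eq_zero_of_lt (show m' k < e' + 1 by omega), Nat.cast_zero]
            ring
        · have hek0 : e k = 0 := Finsupp.notMem_support_iff.mp hek
          rw [if_neg hek, hek0, Nat.choose_zero_right, Nat.choose_zero_right, Nat.cast_one, Nat.sub_zero, Nat.sub_zero, pow_succ]
          ring
      · ------------------------------------------------ `e_j = 0`: the `x_j`-term is absent; the Pascal remainder must vanish
        have hej0 : e j = 0 := Finsupp.notMem_support_iff.mp hej
        rw [if_neg hej, mul_zero, add_zero]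
        by_cases hek : k ∈ e.support
        · have hek1 : 1 ≤ e k := Nat.one_le_iff_ne_zero.mpr (Finsupp.mem_support_iff.mp hek)
          rw [if_pos hek, hT1 hek1, if_pos hed]
          obtain ⟨e', he'⟩ : ∃ e', e k = e' + 1 := ⟨e k - 1, by omega⟩
          rw [he', Nat.choose_succ_succ', Nat.add_sub_cancel, Nat.cast_add, add_mul, add_mul]
          -- the extra term `C(m'_k, e'+1) · b^{…} · Rest` vanishes: either `C = 0` or `Rest = 0`
          by_cases hlt : m' k < e' + 1
          · rw [Nat.choose_eq_zero_of_lt hlt, Nat.cast_zero, zero_mul, zero_mul, add_zero]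
          · rw [hRest0 (by omega)]
            simp only [mul_zero, add_zero]
        · have hek0 : e k = 0 := Finsupp.notMem_support_iff.mp hek
          rw [if_neg hek, hRest0 (by omega), mul_zero]

end ShearMonomial

/-! ## 3. The sheared polynomial and the step: sums over parents -/

section Parents

variable [DecidableEq K]

omit [DecidableEq K] in
/-- **THE COEFFICIENTS OF THE SHEARED POLYNOMIAL AS A SUM OVER PARENTS** (`b_j = 0`):
`coeff_e (shear j b F) = Σ_{m ∈ supp F, |m| = |e|} (∏_{i ≠ j} C(m_i, e_i) b_i^{m_i − e_i}) · coeff_m F`. [OURS · bookkeeping]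
[cite: Hauser2010, §I (definition of P⁺)] -/
theorem coeff_shear_eq_sum_parents (j : Fin 4) {b : Fin 4 → K} (hbj : b j = 0) (F : MvPolynomial (Fin 4) K) (e : Fin 4 →₀ ℕ) :
    coeff e (shear j b F) =
      ∑ m ∈ F.support with m.degree = e.degree,
        (∏ i ∈ Finset.univ.erase j, (((m i).choose (e i) : ℕ) : K) * b i ^ (m i - e i)) * coeff m F := by
  classical
  have hF : shear j b F = ∑ m ∈ F.support, C (coeff m F) * shear j b (monomial m (1 : K)) := by
    conv_lhs => rw [F.as_sum]
    unfold shear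
    rw [map_sum]
    refine Finset.sum_congr rfl fun m _ => ?_
    rw [← mul_one (coeff m F), ← C_mul_monomial, map_mul, aeval_C, mul_one]
    rfl
  rw [hF, coeff_sum, Finset.sum_filter]
  refine Finset.sum_congr rfl fun m _ => ?_
  rw [coeff_C_mul, coeff_shear_monomial j hbj m e]
  by_cases h : m.degree = e.degree
  · rw [if_pos h.symm, if_pos h, mul_comm]
  · rw [if_neg (fun h' => h h'.symm), if_neg h, mul_zero]

/-- **THE STEP EDITION** (one point step, chart `x_j`, chart point `b`, `b_j = 0`, `q ≤ ord F`, `q ≤ |e|`): the child coefficient at the chart image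
`chartExponent q univ j e` is the parent sum of `coeff_shear_eq_sum_parents` — or `0` if the image is a `q`-th power exponent (cleaning).  Taking
`e = E′|… − t` (a lowered image of a parent `x^E`, `t` on the translated letters) gives the birth / cancellation formula of the B-LOSSY text.
[OURS · bookkeeping] [cite: HauserPerlega2019PRIMS, §2 (transform at a translated point)] [cite: Hauser2010, §§F–G, §I] -/
theorem coeff_step_chartExponent_eq_sum_parents (q : ℕ) (j : Fin 4) {b : Fin 4 → K} (hbj : b j = 0) (s : State K)
    (hq : (q : ℕ∞) ≤ ordAlong Finset.univ s.F) {e : Fin 4 →₀ ℕ} (he : q ≤ e.degree) :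
    coeff (chartExponent q Finset.univ j e) (CentreBlowup.step q Finset.univ j b s).F =
      if IsPthPowerExponent q (chartExponent q Finset.univ j e) then 0 else
        ∑ m ∈ s.F.support with m.degree = e.degree,
          (∏ i ∈ Finset.univ.erase j, (((m i).choose (e i) : ℕ) : K) * b i ^ (m i - e i)) * coeff m s.F := by
  rw [coeff_step_F_chartExponent q j hbj s hq he, coeff_shear_eq_sum_parents j hbj s.F e]

omit [DecidableEq K] in
/-- Consistency with `…TranslatedStepWitness`: the DIAGONAL parent `m = e` has weight `1` (`C(e_i, e_i) · b_i^0`). [folklore] -/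
theorem prod_choose_mul_pow_self (j : Fin 4) (b : Fin 4 → K) (e : Fin 4 →₀ ℕ) :
    ∏ i ∈ Finset.univ.erase j, ((((e i).choose (e i) : ℕ) : K) * b i ^ (e i - e i)) = 1 :=
  Finset.prod_eq_one fun i _ => by rw [Nat.choose_self, Nat.cast_one, Nat.sub_self, pow_zero, mul_one]

end Parents

end ResCone

end Summit.ResolutionOfSingularities.ResolutionOfSingularities.Theorems.PIDim4

end
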